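import Summits.QuantumFields.BalabanUV.Beta.FP.KernelPeriodisationFibWoundLetter
import Summits.QuantumFields.BalabanUV.Beta.FP.SecondOrderTableEvenPart
import Summits.QuantumFields.BalabanUV.Beta.CombHId1Letters

/-!
# `BalabanUV.Beta.FP.WoundEvenFamilyTorus` — row D1 ∕ (C1), PART 18: **THE TORUS MATRIX OF THE SOURCE-WOUND EVEN FAMILY IS THE GRADED-EVEN PART OF THE TORUS
# MATRIX OF THE SOURCE-WOUND FAMILY** — for a swap-symmetric `VertexFamily₂` family `W` on a box `M = N·M′`:
# `perF M (dper M (x w ↦ Σ'_e W♮ μ y ν (y′ + M′∘e) x w)) p q = ½·(Ŵ p q + sgnF p.2·sgnF q.2·Ŵ q p)`, `Ŵ := perF M (dper M (x w ↦ Σ'_e W μ y ν (y′ + M′∘e) x w))` —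
# so the END wrapper v5's second-order N rows (stated on the wound EVEN family `WN♮`) read off PART 17's four-word torus readings of the wound `WN`

WHY.  v5 `StepRecursionFeedNestedNamedD` displays `hHN₂ ∕ hQN₂` with right sides `(perF T (dper T (fun x w a b => Σ' e, ((1/2 : ℝ) • (WN … μ y ν (translate (Mc B) y′ e)
+ sgnK (trK (WN … μ y ν (translate (Mc B) y′ e))))) x w a b))).submatrix …`; PART 16∕17 read `perF T (dper T (wound WN))` word by word (N twin of the (C2) series).  The
bridge between the two is linearity under ONE decay letter: the wound family is summable entrywise (each member bi-localised at `(N•y, N•(y′+M′∘e))`, a geometric series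
in `e` — leaf-06 `summable_exp_l1_translate`), so the entrywise `Σ'_e` of the even halves is the even half of the entrywise `Σ'_e` (§1); the wound SUM is bi-localised at
`(N•y, N•y)` (PART 15c `biLoc_sep_of_swap` + PART 15b `biLoc_tsum`), so road «FP»'s `SecondOrderTableEvenPart.perF_dper_evenHalf_apply` applies to it (§2).

WHAT ([folklore] bookkeeping BY NAME; generic dimension `d`, fibre `Fib d`; no `def`, no `def … : Prop`, nothing cited, 0 sorry): §1 `tsum_evenHalf_apply` (any entrywise
summable family), `evenHalf_tsum_eq` (as kernels); §2 `summable_wound_apply`, `biLoc_wound_sum` (the wound sum is `BiLoc … (N•y) (N•y) (Cw·K_{d+1}(δ∕2)) (δ∕4)`),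
**`perF_dper_wound_evenHalf_apply`** (the formula above; at the record: `W := WN (Roots.ctr Lc) Pn (n+1)`, `hs := TowerNParityRowsEven.WN_swap …`, `hW := hWN n`,
`M := towerTorus Lc (fine Lc (Mc B)) (n+1)`, `M′ := Mc B`, `N := NN n` — v5's right sides entrywise, CHARACTER FOR CHARACTER up to β-reduction).
WHAT THIS IS NOT: no row of the END wrapper discharged; not the (C1) table word; nothing of Bałaban's asserted, valued or discharged; 0 estimates beyond [folklore] geometric
series; 0∕4 row-D1 binders (hW, hR, D1Tel, D1Rep); ROOT M‴ p325680 ∕ P5c ∕ D6 untouched; NOT (C1), NOT (T-ID), NOT D1, NEVER «G-an2-4 closed», NOT BetaPertH, NOT continuum,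
NOT Clay.

HONEST DEPENDENCY (page 1, mandatory): continuum YM on T⁴ ⇐ BetaPertH ∧ nine spine estimates (0/9 proved); BetaPertH ⇐ (D1) ∧ (D4) ∧ CAP+tail;
G-an2-4 gates asym, D1 and NE2/3/4.  HONEST FRAMING (cell contract, verbatim): «discharging `BetaPertH` makes Bałaban's UV stability UNCONDITIONAL —
a real constructive-QFT result; it is NOT the continuum limit and NOT the Clay problem.»  ABSOLUTE RULE (cell charter, verbatim): «No internally-minted
statement may enter as a cited fact. Every hypothesis is either kernel-proved in this package or a verbatim quotation of a PUBLISHED theorem with page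
reference. The manuscript(s) under audit are NOT citable for their own disputed steps — they are the thing under adjudication; programme-internal
(2001/route/tribunal) claims are never citable.»  Row D1 ∕ (C1) OWNER an2 (b2b-balaban-beta-an2) gen 68, 2026-08-27.  No existing file touched.
-/

noncomputable section

open scoped BigOperators Matrix

namespace Summit.QuantumFields.BalabanUV.Beta.FP.WoundEvenFamilyTorus

open Literature.MathematicalPhysics.QuantumFieldTheory.Balaban1983to89
open Literature.MathematicalPhysics.QuantumFieldTheory.Balaban1983to89.Beta
open B12Sec2to5 (l1 l1_nonneg)
open B4TorusKernel.MultiPeriod (translate translate_apply)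
open B4Sect5Proof (latticeConst latticeConst_nonneg)
open B6Lemma24Torus (pbox)
open ExpKernelCalculus (MKer Decays BiLoc VertexFamily₂)
open OneStepResolventKernel (Fib)
open Summit.QuantumFields.BalabanUV.Beta.TameKernelCalculus (trK trK_apply)
open Summit.QuantumFields.BalabanUV.Beta.BorderedHessian (sgnF sgnK sgnK_apply)
open Summit.QuantumFields.BalabanUV.Beta.CombHId1Letters (nsmul_translate)
open Summit.QuantumFields.BalabanUV.Beta.FP.KernelPeriodisationFib (Idx perF)
open Summit.QuantumFields.BalabanUV.Beta.FP.KernelPeriodisationFibLoc (dper summable_exp_l1_translate)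
open Summit.QuantumFields.BalabanUV.Beta.FP.KernelPeriodisationFibWoundLimit (summable_apply_of_biLoc biLoc_tsum)
open Summit.QuantumFields.BalabanUV.Beta.FP.KernelPeriodisationFibWoundLetter (biLoc_sep_of_swap)
open Summit.QuantumFields.BalabanUV.Beta.FP.SecondOrderTableEvenPart (perF_dper_evenHalf_apply)

variable {d : ℕ}

/-! ## §1 The entrywise sum of the even halves is the even half of the entrywise sum -/

section EvenHalf

variable {ι : Type*} {K : ι → MKer (d + 1) (Fib d)}

/-- [folklore] for an entrywise summable family, `Σ'_e (½•(K e + (K e)ᴾ)) x z a b = (½•(Σ'_e K e + (Σ'_e K e)ᴾ)) x z a b` (`tsum_add`, `tsum_mul_left`; `(·)ᴾ = sgnK ∘ trK`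
is entrywise). -/
theorem tsum_evenHalf_apply (hK : ∀ x z a b, Summable fun e => K e x z a b) (x z : Fin (d + 1) → ℤ) (a b : Fib d) :
    (∑' e, ((1 / 2 : ℝ) • (K e + sgnK (trK (K e)))) x z a b)
      = ((1 / 2 : ℝ) • ((fun x z a b => ∑' e, K e x z a b) + sgnK (trK (fun x z a b => ∑' e, K e x z a b)))) x z a b := by
  simp only [Pi.smul_apply, Pi.add_apply, sgnK_apply, trK_apply, smul_eq_mul]
  rw [tsum_mul_left, (hK x z a b).tsum_add ((hK z x b a).mul_left _), tsum_mul_left]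

/-- [folklore] the same as an equality of kernels. -/
theorem evenHalf_tsum_eq (hK : ∀ x z a b, Summable fun e => K e x z a b) :
    (fun x z a b => ∑' e, ((1 / 2 : ℝ) • (K e + sgnK (trK (K e)))) x z a b)
      = (1 / 2 : ℝ) • ((fun x z a b => ∑' e, K e x z a b) + sgnK (trK (fun x z a b => ∑' e, K e x z a b))) := by
  funext x z a b
  exact tsum_evenHalf_apply hK x z a b

end EvenHalf

/-! ## §2 The source-wound family of a swap-symmetric `VertexFamily₂` family: summability, bi-localisation of the sum, the torus face of its even half -/

section Wound

variable (M : Fin (d + 1) → ℕ) [∀ μ, NeZero (M μ)] {M' : Fin (d + 1) → ℕ} {N : ℕ}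
  {W : Fin (d + 1) → (Fin (d + 1) → ℤ) → Fin (d + 1) → (Fin (d + 1) → ℤ) → MKer (d + 1) (Fib d)} {Cw δ : ℝ}

/-- [folklore] **the source-wound family is summable entrywise** (each member bi-localised at `(N•y, N•(y′+M′∘e))`; the second leg's factors are a geometric series in `e` —
leaf-06 `summable_exp_l1_translate` on the fine box). -/
theorem summable_wound_apply (hM : ∀ i, M i = N * M' i) (hW : VertexFamily₂ W N Cw δ) (hδ : 0 < δ)
    (μ : Fin (d + 1)) (y : Fin (d + 1) → ℤ) (ν : Fin (d + 1)) (y' x z : Fin (d + 1) → ℤ) (a b : Fib d) :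
    Summable fun e : Fin (d + 1) → ℤ => W μ y ν (translate M' y' e) x z a b := by
  have hCw : 0 ≤ Cw := (hW μ y ν y').nonneg (Sum.inl 0)
  obtain ⟨hs, -⟩ := summable_exp_l1_translate M hδ z ((N : ℤ) • y')
  refine .of_norm_bounded (hs.mul_left Cw) fun e => ?_
  rw [Real.norm_eq_abs]
  refine (hW μ y ν (translate M' y' e) x z a b).trans ?_
  rw [nsmul_translate hM]
  refine mul_le_mul_of_nonneg_left (Real.exp_le_exp.2 ?_) hCw
  rw [ExpKernelCalculus.l1_sub_symm z]
  nlinarith [l1_nonneg (x - (N : ℤ) • y), l1_nonneg (translate M ((N : ℤ) • y') e - z)]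

/-- [folklore] **the source-wound SUM of a swap-symmetric `VertexFamily₂` family is bi-localised at `(N•y, N•y)`**, constant `Cw·K_{d+1}(δ∕2)`, rate `δ∕4`
(PART 15c `biLoc_sep_of_swap` member by member + PART 15b `biLoc_tsum`; the constants sum by leaf-06 `summable_exp_l1_translate`). -/
theorem biLoc_wound_sum (hM : ∀ i, M i = N * M' i) (hs : ∀ μ y ν y', W ν y' μ y = W μ y ν y') (hW : VertexFamily₂ W N Cw δ) (hδ : 0 < δ)
    (μ : Fin (d + 1)) (y : Fin (d + 1) → ℤ) (ν : Fin (d + 1)) (y' : Fin (d + 1) → ℤ) :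
    BiLoc (fun x z a b => ∑' e : Fin (d + 1) → ℤ, W μ y ν (translate M' y' e) x z a b) ((N : ℤ) • y) ((N : ℤ) • y)
      (Cw * latticeConst (d + 1) (δ / 2)) (δ / 4) := by
  have hCw : 0 ≤ Cw := (hW μ y ν y').nonneg (Sum.inl 0)
  obtain ⟨hsum, hle⟩ := summable_exp_l1_translate M (half_pos hδ) ((N : ℤ) • y) ((N : ℤ) • y')
  have hmem : ∀ e : Fin (d + 1) → ℤ, BiLoc (W μ y ν (translate M' y' e)) ((N : ℤ) • y) ((N : ℤ) • y)
      (Cw * Real.exp (-(δ / 2) * l1 (translate M ((N : ℤ) • y') e - (N : ℤ) • y))) (δ / 4) := fun e => by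
    have h := biLoc_sep_of_swap hs hW hδ.le μ y ν (translate M' y' e)
    rwa [nsmul_translate hM] at h
  have h := biLoc_tsum hmem (hsum.mul_left Cw)
  rw [tsum_mul_left] at h
  exact fun x z a b => (h x z a b).trans (mul_le_mul_of_nonneg_right (mul_le_mul_of_nonneg_left hle hCw) (Real.exp_pos _).le)

/-- [folklore] **`perF_dper_wound_evenHalf_apply` — THE TORUS MATRIX OF THE SOURCE-WOUND EVEN FAMILY**: for a swap-symmetric `VertexFamily₂` family `W` (rate `δ > 0`) on a box
`M = N·M′`, with `Ŵ := perF M (dper M (x w ↦ Σ'_e W μ y ν (y′ + M′∘e) x w))`,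
`perF M (dper M (x w ↦ Σ'_e (½•(W μ y ν (y′+M′∘e) + (W μ y ν (y′+M′∘e))ᴾ)) x w)) p q = ½·(Ŵ p q + sgnF p.2·sgnF q.2·Ŵ q p)`
(§1 under `summable_wound_apply`, then road «FP» `SecondOrderTableEvenPart.perF_dper_evenHalf_apply` at `biLoc_wound_sum`). -/
theorem perF_dper_wound_evenHalf_apply (hM : ∀ i, M i = N * M' i) (hs : ∀ μ y ν y', W ν y' μ y = W μ y ν y') (hW : VertexFamily₂ W N Cw δ) (hδ : 0 < δ)
    (μ : Fin (d + 1)) (y : Fin (d + 1) → ℤ) (ν : Fin (d + 1)) (y' : Fin (d + 1) → ℤ) (p q : Idx M (Fib d)) :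
    perF M (dper M (fun x w a b => ∑' e : Fin (d + 1) → ℤ,
        ((1 / 2 : ℝ) • (W μ y ν (translate M' y' e) + sgnK (trK (W μ y ν (translate M' y' e))))) x w a b)) p q
      = (1 / 2 : ℝ) * (perF M (dper M (fun x w a b => ∑' e : Fin (d + 1) → ℤ, W μ y ν (translate M' y' e) x w a b)) p q
          + sgnF p.2 * sgnF q.2 * perF M (dper M (fun x w a b => ∑' e : Fin (d + 1) → ℤ, W μ y ν (translate M' y' e) x w a b)) q p) := by
  have hCw : 0 ≤ Cw := (hW μ y ν y').nonneg (Sum.inl 0)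
  rw [evenHalf_tsum_eq (K := fun e => W μ y ν (translate M' y' e)) (fun x z a b => summable_wound_apply M hM hW hδ μ y ν y' x z a b)]
  exact perF_dper_evenHalf_apply M (biLoc_wound_sum M hM hs hW hδ μ y ν y') (mul_nonneg hCw (latticeConst_nonneg _ (half_pos hδ).le)) (by positivity) p q

end Wound

end Summit.QuantumFields.BalabanUV.Beta.FP.WoundEvenFamilyTorus

end
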